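import Summits.QuantumFields.YangMills.Theorems.BalabanUVNodesN08HaarCompatibilityGuardJacobianDetSU

/-!
# BalabanUVNodes ∕ N08 — FRAME CALCULUS FOR THE UPPER HALF OF THE JACOBIAN PINCH (part 3a of the contraction series):
# `ψ ≥ 0` and monotone, the full ratio `e^{−iθₐ}∕dd = (1 − ψβ) − iβ`, real frame multipliers, Cauchy–Schwarz for a psd hs-symmetric operator

WIDTH SEAT `pub-ymgap-dag-n08-w6` g4 (R399 (3a) second wave; CLAIM-2 ∕ INTENT-3 of record HOME INBOX l.32241, successor of CLAIM-1 = p616149 ✓ ∕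
p617624 ✓), 2026-08-28.  Track A, DAG node N08 = [Balaban1985UV3] Thm 1 p. 257 (compact) + Thm 2 p. 272; key item K1⁷ `StabilityBAtRecordR13SepCoPH`
(stmt-QuantumFields-20542), `--supports … --as helper`.  COUNT-NEUTRAL.

THE POINT OF THE SERIES.  For `K_W = exp(Σᵢ cᵢ log(hᵢ W*))·W` (pub-balaban's `Kmat`; unitary `W`, unitaries `hᵢ` in the guard `‖hᵢW* − 1‖ < 1∕2`,
`cᵢ ≥ 0`, `Σcᵢ ≤ 1`) this seat's g3 proved the LOWER half `(1 − Σcᵢ)·‖X‖ ≤ ‖D K_W(WX)‖_HS` (p612264) and g4 its determinant form (p616149 ∕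
p617624).  The UPPER half — «the tangent map is an hs-CONTRACTION», `‖D K_W(WX)‖_HS ≤ (1 − Σcᵢρᵢcot ρᵢ)·‖X‖_HS ≤ ‖X‖_HS` with `ρᵢ ≥ ‖log(hᵢW*)‖`,
the «tangent UPPER bound» sibling n08-w3's one-window engine frame names (p616325 header, (E4)) — rests on the structure
`D K_W(WX)·W* = dexp(Y)·Q X̃`, `Q = φ(B_Y) − Σcᵢφ(B_{Zᵢ})` (`φ(β) = β cot β = 1 − ψβ`), with `Q` hs-SYMMETRIC and `0 ⪯ Q ⪯ (1 − Σcᵢ(1 − ψρᵢ))·1`.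
This file supplies the frame-level tools; part 3b (`…ContractionOperator`) assembles them; part 3c (`…ContractionDet`) gives the determinant pinch.

WHAT THIS FILE PROVES ([folklore] real analysis ∕ linear algebra over pub-balaban's `T4EMLTangentInjective` frame API and g3's `…SharpFrame` BY IMPORT).
* §1 `ψ_nonneg_of_abs_lt_pi`, `ψ_le_ψ_of_abs_le` (monotone in `|β|` on `[0, π)`), `ψ_one_lt_one`, `ψ_le_one_of_abs_le_one` — termwise from the
  Mittag-Leffler series `ψ(β) = Σₙ 2β²∕((n+1)²π² − β²)` (pub-balaban's `hasSum_ψ'`); ★ `exp_div_dd_eq`: `e^{−iθₐ}∕dd(−iθₐ,−iθ_b) = (1 − ψβ) − iβ`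
  (`β = (θₐ−θ_b)∕2`, `|β| < π`) — the real part is pub-balaban's `dd_ratio`, the imaginary part `−β` is the `½ad_Z` half of the solution operator.
* §2 ★ `hs_symm_psd_cs` (Cauchy–Schwarz for the form `hs(·, Q·)` of an additive, real-homogeneous, hs-symmetric, psd `Q`) and
  ★ `hs_apply_self_le_of_symm_psd`: `0 ⪯ Q ⪯ κ·1 ⟹ hs(Qx, Qx) ≤ κ²·hs(x, x)`.
* §3 frame multipliers `X ↦ U·(w ⊙ U*XU)·U*`: additivity∕homogeneity, the forms `hs(X₁, ·X₂)` (`hs_frameMul_right∕left`), ★ SYMMETRY for real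
  weights (`hs_frameMul_symm`), the quadratic form `Σ r_{ab}|X'_{ab}|²` and its two bounds (`hs_frameMul_self(_le∕_ge)`), the contraction for
  `|w| ≤ 1` (`hs_frameMul_frameMul_le`), and `½ad_Z` as the frame multiplier `−iβ_{ab}` (`adh_frame`).

HONEST FRAMING.  Count-neutral helper; [folklore] tools only; nothing of Bałaban's asserted; no density bound ∕ engine ∕ sheet count typed; E6′ NOT decided;
`hmass` NOT supplied; N08 NOT discharged; counts unmoved (typed 28∕28 · discharged 5∕27); no summit statement is proved by this seat — one finite 𝕋⁴ programme
at fixed ε, R4 closes the CONDITIONAL rung `BalabanLadder.UV` only; the Yang–Mills mass gap (Clay) is NOT proved by any of this; nothing continuum ∕ ℝ⁴ ∕ OS.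
0 `sorry`, 0 `def`, 0 `instance`, 0 `notation`, standard axioms.
-/

noncomputable section

open NormedSpace Finset
open scoped Matrix Matrix.Norms.L2Operator ComplexConjugate Nat

namespace Summit.QuantumFields.YangMills.BalabanUVNodes.N08HaarCompatibilityGuardJacobianContractionFrame

open Literature.MathematicalPhysics.QuantumFieldTheory.Balaban1983to89
open Literature.MathematicalPhysics.QuantumFieldTheory.Balaban1983to89.T4EMLTangentInjective
open Summit.QuantumFields.YangMills.BalabanUVNodes.N08HaarCompatibilityGuardJacobian
open Summit.QuantumFields.YangMills.BalabanUVNodes.N08HaarCompatibilityGuardJacobianSharpFrame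
open Summit.QuantumFields.YangMills.BalabanUVNodes.N08HaarCompatibilityGuardJacobianSharp
open Matrix (single diagonal unitaryGroup)
open Complex (I)
open T4QuatExpLog (ψ ψ_zero ψ_of_ne_zero)

variable {m : Type*} [Fintype m] [DecidableEq m] [Nonempty m] {ι : Type*} [Fintype ι]

/-! ## §1 Scalar facts: `ψ ≥ 0` and `ψ` increasing on `[0, π)` (Mittag-Leffler termwise); the full coefficient ratio `e^{−iθₐ}∕dd = (1 − ψβ) − iβ` -/

omit [Fintype m] [DecidableEq m] [Nonempty m] [Fintype ι] in
/-- `0 ≤ ψ β` for `|β| < π`: every Mittag-Leffler term `2β²∕((n+1)²π² − β²)` is non-negative. [folklore] -/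
theorem ψ_nonneg_of_abs_lt_pi {β : ℝ} (hβ : |β| < Real.pi) : 0 ≤ ψ β := by
  refine (hasSum_ψ' hβ).nonneg fun n => div_nonneg (by positivity) ?_
  have h1 : β ^ 2 < Real.pi ^ 2 := by
    have := sq_lt_sq' (abs_lt.1 hβ).1 (abs_lt.1 hβ).2; simpa using this
  have h2 : Real.pi ^ 2 ≤ ((n : ℝ) + 1) ^ 2 * Real.pi ^ 2 := by
    have : (1 : ℝ) ≤ ((n : ℝ) + 1) ^ 2 := by nlinarith [(n.cast_nonneg : (0 : ℝ) ≤ n)]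
    nlinarith [Real.pi_pos]
  linarith

omit [Fintype m] [DecidableEq m] [Nonempty m] [Fintype ι] in
/-- **`ψ` is increasing in `|β|` on `[0, π)`**: `|β| ≤ ρ < π ⟹ ψ β ≤ ψ ρ` (each Mittag-Leffler term is increasing in `β²`), i.e.
`β cot β ≥ ρ cot ρ`. [folklore] -/
theorem ψ_le_ψ_of_abs_le {β ρ : ℝ} (hβρ : |β| ≤ ρ) (hρ : ρ < Real.pi) : ψ β ≤ ψ ρ := by
  have hρ0 : 0 ≤ ρ := (abs_nonneg β).trans hβρ
  have hβπ : |β| < Real.pi := hβρ.trans_lt hρ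
  have hρπ : |ρ| < Real.pi := by rwa [abs_of_nonneg hρ0]
  refine hasSum_le (fun n => ?_) (hasSum_ψ' hβπ) (hasSum_ψ' hρπ)
  have hb2 : β ^ 2 ≤ ρ ^ 2 := by
    have := sq_le_sq' (by linarith [(abs_le.1 hβρ).1]) (abs_le.1 hβρ).2; simpa using this
  have h1 : ρ ^ 2 < Real.pi ^ 2 := by
    have := sq_lt_sq' (abs_lt.1 hρπ).1 (abs_lt.1 hρπ).2; simpa using this
  have h2 : Real.pi ^ 2 ≤ ((n : ℝ) + 1) ^ 2 * Real.pi ^ 2 := by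
    have : (1 : ℝ) ≤ ((n : ℝ) + 1) ^ 2 := by nlinarith [(n.cast_nonneg : (0 : ℝ) ≤ n)]
    nlinarith [Real.pi_pos]
  set R : ℝ := ((n : ℝ) + 1) ^ 2 * Real.pi ^ 2
  have hRβ : 0 < R - β ^ 2 := by linarith
  have hRρ : 0 < R - ρ ^ 2 := by linarith
  rw [div_le_div_iff₀ hRβ hRρ]
  nlinarith

omit [Fintype m] [DecidableEq m] [Nonempty m] [Fintype ι] in
/-- `0 ≤ 1 − ψ β ≤ 1`-type facts: `1 − ψ β ≤ 1` for `|β| < π`. [folklore] -/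
theorem one_sub_ψ_le_one {β : ℝ} (hβ : |β| < Real.pi) : 1 - ψ β ≤ 1 := by
  linarith [ψ_nonneg_of_abs_lt_pi hβ]

omit [Fintype m] [DecidableEq m] [Nonempty m] [Fintype ι] in
/-- `ψ 1 = 1 − cot 1 < 1` (`cos 1 > 0`, `sin 1 > 0`). [folklore] -/
theorem ψ_one_lt_one : ψ 1 < 1 := by
  rw [ψ_of_ne_zero one_ne_zero, one_mul]
  have hc := Real.cos_one_pos
  have hs := Real.sin_pos_of_pos_of_lt_pi one_pos (by linarith [Real.pi_gt_three])
  linarith [div_pos hc hs]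

omit [Fintype m] [DecidableEq m] [Nonempty m] [Fintype ι] in
/-- `ψ ρ ≤ 1` for `|ρ| ≤ 1`, i.e. `ρ cot ρ ≥ 0` there (monotonicity and `ψ 1 < 1`). [folklore] -/
theorem ψ_le_one_of_abs_le_one {ρ : ℝ} (hρ : |ρ| ≤ 1) : ψ ρ ≤ 1 :=
  (ψ_le_ψ_of_abs_le hρ (by linarith [Real.pi_gt_three])).trans ψ_one_lt_one.le

omit [Fintype m] [DecidableEq m] [Nonempty m] [Fintype ι] in
/-- **The full coefficient ratio**: for `|β| < π`, `β = (θₐ − θ_b)∕2`,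
`e^{−iθₐ} ∕ dd(−iθₐ, −iθ_b) = (1 − ψ β) − i·β` — real part `β cot β` (`dd_ratio`), imaginary part `−β` (the `½ad` half of the solution
operator `dexp(Z)⁻¹ ∘ (exp Z ·)`). [folklore] -/
theorem exp_div_dd_eq {θa θb : ℝ} (hβ : |(θa - θb) / 2| < Real.pi) :
    Complex.exp (-I * θa) / dd (-I * θa) (-I * θb)
      = ((1 - ψ ((θa - θb) / 2) : ℝ) : ℂ) - I * (((θa - θb) / 2 : ℝ) : ℂ) := by
  set β : ℝ := (θa - θb) / 2 with hβdef
  by_cases hab : θa = θb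
  · subst hab
    have h0 : β = 0 := by rw [hβdef]; simp
    rw [dd, if_pos rfl, div_self (Complex.exp_ne_zero _), h0, ψ_zero]
    simp
  · have hβ0 : β ≠ 0 := by rw [hβdef]; intro h; apply hab; linarith [div_eq_zero_iff.1 h]
    have hsin : Real.sin β ≠ 0 := by
      intro h0
      rw [Real.sin_eq_zero_iff_of_lt_of_lt (by linarith [(abs_lt.1 hβ).1]) (abs_lt.1 hβ).2] at h0
      exact hβ0 h0
    rw [dd_eq_exp_half_mul hab]
    have he : Complex.exp (-I * θa) = Complex.exp ((-I * θa + -I * θb) / 2) * Complex.exp (-(β : ℂ) * I) := by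
      rw [← Complex.exp_add]; congr 1; rw [hβdef]; push_cast; ring
    rw [he, mul_div_mul_left _ _ (Complex.exp_ne_zero _), ψ_of_ne_zero hβ0, sub_sub_cancel, ← hβdef]
    clear_value β
    clear he hβdef
    have hsc : (((Real.sin β / β : ℝ)) : ℂ) ≠ 0 := Complex.ofReal_ne_zero.2 (div_ne_zero hsin hβ0)
    have hsC : (Real.sin β : ℂ) ≠ 0 := Complex.ofReal_ne_zero.2 hsin
    have hβC : (β : ℂ) ≠ 0 := Complex.ofReal_ne_zero.2 hβ0
    rw [div_eq_iff hsc, show -(β : ℂ) * I = ((-β : ℝ) : ℂ) * I by push_cast; ring, Complex.exp_mul_I,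
      ← Complex.ofReal_cos, ← Complex.ofReal_sin, Real.cos_neg, Real.sin_neg, Complex.ofReal_neg, Complex.ofReal_div,
      Complex.ofReal_div, Complex.ofReal_mul]
    field_simp
    ring

/-! ## §2 [folklore] Cauchy–Schwarz for a positive-semidefinite hs-symmetric operator: `0 ⪯ Q ⪯ κ ⟹ ‖Q x‖² ≤ κ²‖x‖²` -/

omit [DecidableEq m] [Nonempty m] [Fintype ι] in
/-- **Cauchy–Schwarz for the form `hs(·, Q·)`** of an additive, real-homogeneous, hs-symmetric, positive-semidefinite `Q`:
`hs(u, Qv)² ≤ hs(u, Qu)·hs(v, Qv)`. [folklore] -/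
theorem hs_symm_psd_cs {Q : Matrix m m ℂ → Matrix m m ℂ} (hadd : ∀ x y, Q (x + y) = Q x + Q y)
    (hsmul : ∀ (t : ℝ) (x : Matrix m m ℂ), Q ((t : ℂ) • x) = (t : ℂ) • Q x) (hsymm : ∀ x y, hs x (Q y) = hs (Q x) y)
    (hpos : ∀ x, 0 ≤ hs x (Q x)) (u v : Matrix m m ℂ) :
    hs u (Q v) * hs u (Q v) ≤ hs u (Q u) * hs v (Q v) := by
  have hsub : ∀ x y : Matrix m m ℂ, Q (x - y) = Q x - Q y := fun x y => by
    have h1 : Q (x - y) + Q y = Q x := by rw [← hadd, sub_add_cancel]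
    exact eq_sub_of_add_eq h1
  have hvu : hs v (Q u) = hs u (Q v) := by rw [hsymm, hs_comm]
  set a := hs v (Q v) with ha
  set b := hs u (Q v) with hb
  set d := hs u (Q u) with hd
  have ha0 : 0 ≤ a := hpos v
  have hd0 : 0 ≤ d := hpos u
  -- the quadratic `t ↦ hs(u − t v, Q(u − t v)) = d − 2 t b + t² a ≥ 0`
  have hquad : ∀ t : ℝ, 0 ≤ d - 2 * t * b + t * t * a := by
    intro t
    have h := hpos (u - (t : ℂ) • v)
    rw [hsub, hsmul, hs_sub_left, hs_sub_right, hs_sub_right, hs_smul_left, hs_smul_left, hs_smul_right, hs_smul_right,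
      hvu] at h
    linarith
  rcases ha0.lt_or_eq with hapos | haz
  · have h := hquad (b / a)
    have e : d - 2 * (b / a) * b + b / a * (b / a) * a = (d * a - b * b) / a := by field_simp; ring
    rw [e] at h
    have := (div_nonneg_iff.1 h)
    rcases this with ⟨h1, -⟩ | ⟨-, h2⟩
    · nlinarith
    · exact absurd h2 (not_le.2 hapos)
  · -- `a = 0`: the linear function `d − 2tb` is non-negative for all `t`, so `b = 0`
    have hb0 : b = 0 := by
      by_contra hbne
      have h := hquad ((d + 1) / (2 * b))
      rw [← haz, mul_zero, add_zero] at h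
      have e : d - 2 * ((d + 1) / (2 * b)) * b = -1 := by field_simp; ring
      linarith
    rw [hb0, ← haz]; simp

omit [DecidableEq m] [Nonempty m] [Fintype ι] in
/-- **`0 ⪯ Q ⪯ κ·1 ⟹ ‖Q x‖²_HS ≤ κ²·‖x‖²_HS`** for an additive, real-homogeneous, hs-symmetric `Q` (Cauchy–Schwarz for the form
`hs(·, Q·)` at the pair `(Qx, x)`, then the two form bounds at `x` and at `Qx`). [folklore] -/
theorem hs_apply_self_le_of_symm_psd {Q : Matrix m m ℂ → Matrix m m ℂ} (hadd : ∀ x y, Q (x + y) = Q x + Q y)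
    (hsmul : ∀ (t : ℝ) (x : Matrix m m ℂ), Q ((t : ℂ) • x) = (t : ℂ) • Q x) (hsymm : ∀ x y, hs x (Q y) = hs (Q x) y)
    (hpos : ∀ x, 0 ≤ hs x (Q x)) {κ : ℝ} (hκ : 0 ≤ κ) (hup : ∀ x, hs x (Q x) ≤ κ * hs x x) (x : Matrix m m ℂ) :
    hs (Q x) (Q x) ≤ κ ^ 2 * hs x x := by
  have hcs := hs_symm_psd_cs hadd hsmul hsymm hpos (Q x) x
  -- `hs (Qx) (Q x) = p`, `hs (Qx) (Q (Qx)) ≤ κ p`, `hs x (Q x) ≤ κ hs x x`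
  set p := hs (Q x) (Q x) with hp
  have hp0 : 0 ≤ p := hs_self_nonneg _
  have hxx : 0 ≤ hs x x := hs_self_nonneg _
  have h1 : hs (Q x) (Q (Q x)) ≤ κ * p := hup (Q x)
  have h2 : hs x (Q x) ≤ κ * hs x x := hup x
  have h3 : p * p ≤ (κ * p) * (κ * hs x x) :=
    hcs.trans (mul_le_mul h1 h2 (hpos x) (by nlinarith))
  rcases hp0.lt_or_eq with hpos' | hz
  · nlinarith
  · rw [← hz]; nlinarith

/-! ## §3 Frame multipliers `X ↦ U·(w ⊙ U*XU)·U*`: linearity, the form `hs(X₁, ·X₂)`, symmetry for real weights, bounds -/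

section FrameMul

variable {U : Matrix m m ℂ}

omit [DecidableEq m] [Nonempty m] [Fintype ι] in
/-- Additivity of a frame multiplier. [folklore] -/
theorem frameMul_add (w : m → m → ℂ) (X Y : Matrix m m ℂ) :
    U * Matrix.of (fun a b => w a b * (star U * (X + Y) * U) a b) * star U
      = U * Matrix.of (fun a b => w a b * (star U * X * U) a b) * star U
        + U * Matrix.of (fun a b => w a b * (star U * Y * U) a b) * star U := by
  rw [← Matrix.add_mul, ← Matrix.mul_add]
  congr 2
  ext a b
  simp only [Matrix.of_apply, Matrix.add_apply, Matrix.add_mul, mul_add]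

omit [DecidableEq m] [Nonempty m] [Fintype ι] in
/-- Homogeneity of a frame multiplier. [folklore] -/
theorem frameMul_smul (w : m → m → ℂ) (t : ℂ) (X : Matrix m m ℂ) :
    U * Matrix.of (fun a b => w a b * (star U * (t • X) * U) a b) * star U
      = t • (U * Matrix.of (fun a b => w a b * (star U * X * U) a b) * star U) := by
  rw [← Matrix.smul_mul, ← Matrix.mul_smul]
  congr 2
  ext a b
  simp only [Matrix.of_apply, Matrix.smul_apply, Matrix.mul_smul, Matrix.smul_mul, smul_eq_mul]
  ring

omit [Nonempty m] [Fintype ι] in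
/-- The form of a frame multiplier: `hs(X₁, U(w ⊙ X₂')U*) = Σ Re(conj(X₁'_{ab})·w_{ab}·X₂'_{ab})`. [folklore] -/
theorem hs_frameMul_right (hU : star U * U = 1) (hU' : U * star U = 1) (w : m → m → ℂ) (X₁ X₂ : Matrix m m ℂ) :
    hs X₁ (U * Matrix.of (fun a b => w a b * (star U * X₂ * U) a b) * star U)
      = ∑ a, ∑ b, (star ((star U * X₁ * U) a b) * (w a b * (star U * X₂ * U) a b)).re := by
  conv_lhs => rw [(conj_unconj hU' X₁).symm]
  rw [hs_frame hU]
  rfl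

omit [Nonempty m] [Fintype ι] in
/-- The form of a frame multiplier on the left: `hs(U(w ⊙ X₁')U*, X₂) = Σ Re(conj(w_{ab}·X₁'_{ab})·X₂'_{ab})`. [folklore] -/
theorem hs_frameMul_left (hU : star U * U = 1) (hU' : U * star U = 1) (w : m → m → ℂ) (X₁ X₂ : Matrix m m ℂ) :
    hs (U * Matrix.of (fun a b => w a b * (star U * X₁ * U) a b) * star U) X₂
      = ∑ a, ∑ b, (star (w a b * (star U * X₁ * U) a b) * (star U * X₂ * U) a b).re := by
  conv_lhs => rw [(conj_unconj hU' X₂).symm]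
  rw [hs_frame hU]
  rfl

omit [Nonempty m] [Fintype ι] in
/-- **A frame multiplier with REAL weights is hs-symmetric.** [folklore] -/
theorem hs_frameMul_symm (hU : star U * U = 1) (hU' : U * star U = 1) (r : m → m → ℝ) (X₁ X₂ : Matrix m m ℂ) :
    hs X₁ (U * Matrix.of (fun a b => ((r a b : ℝ) : ℂ) * (star U * X₂ * U) a b) * star U)
      = hs (U * Matrix.of (fun a b => ((r a b : ℝ) : ℂ) * (star U * X₁ * U) a b) * star U) X₂ := by
  rw [hs_frameMul_right hU hU', hs_frameMul_left hU hU']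
  refine Finset.sum_congr rfl fun a _ => Finset.sum_congr rfl fun b _ => ?_
  rw [star_mul, Complex.star_def, Complex.conj_ofReal]
  ring_nf

omit [Nonempty m] [Fintype ι] in
/-- The quadratic form of a real frame multiplier: `hs(X, U(r ⊙ X')U*) = Σ r_{ab}·|X'_{ab}|²`. [folklore] -/
theorem hs_frameMul_self (hU : star U * U = 1) (hU' : U * star U = 1) (r : m → m → ℝ) (X : Matrix m m ℂ) :
    hs X (U * Matrix.of (fun a b => ((r a b : ℝ) : ℂ) * (star U * X * U) a b) * star U)
      = ∑ a, ∑ b, r a b * ‖(star U * X * U) a b‖ ^ 2 := by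
  rw [hs_frameMul_right hU hU']
  refine Finset.sum_congr rfl fun a _ => Finset.sum_congr rfl fun b _ => ?_
  rw [show star ((star U * X * U) a b) * (((r a b : ℝ) : ℂ) * (star U * X * U) a b)
      = ((r a b : ℝ) : ℂ) * (star ((star U * X * U) a b) * (star U * X * U) a b) by ring,
    Complex.star_def, Complex.conj_mul', ← Complex.ofReal_pow, ← Complex.ofReal_mul, Complex.ofReal_re]

omit [Nonempty m] [Fintype ι] in
/-- `hs(X, X) = Σ |X'_{ab}|²` in any frame. [folklore] -/
theorem hs_self_eq_frame (hU : star U * U = 1) (hU' : U * star U = 1) (X : Matrix m m ℂ) :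
    hs X X = ∑ a, ∑ b, ‖(star U * X * U) a b‖ ^ 2 := by
  conv_lhs => rw [(conj_unconj hU' X).symm]
  rw [hs_frame hU]
  refine Finset.sum_congr rfl fun a _ => Finset.sum_congr rfl fun b _ => ?_
  rw [Complex.star_def, Complex.conj_mul', ← Complex.ofReal_pow, Complex.ofReal_re]

omit [Nonempty m] [Fintype ι] in
/-- **Upper form bound**: real weights `≤ 1` ⟹ `hs(X, U(r ⊙ X')U*) ≤ hs(X, X)`. [folklore] -/
theorem hs_frameMul_self_le (hU : star U * U = 1) (hU' : U * star U = 1) {r : m → m → ℝ} (hr : ∀ a b, r a b ≤ 1)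
    (X : Matrix m m ℂ) :
    hs X (U * Matrix.of (fun a b => ((r a b : ℝ) : ℂ) * (star U * X * U) a b) * star U) ≤ hs X X := by
  rw [hs_frameMul_self hU hU', hs_self_eq_frame hU hU' X]
  refine Finset.sum_le_sum fun a _ => Finset.sum_le_sum fun b _ => ?_
  nlinarith [hr a b, sq_nonneg ‖(star U * X * U) a b‖]

omit [Nonempty m] [Fintype ι] in
/-- **Lower form bound**: real weights `≥ r₀` ⟹ `r₀·hs(X, X) ≤ hs(X, U(r ⊙ X')U*)`. [folklore] -/
theorem hs_frameMul_self_ge (hU : star U * U = 1) (hU' : U * star U = 1) {r : m → m → ℝ} {r₀ : ℝ} (hr : ∀ a b, r₀ ≤ r a b)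
    (X : Matrix m m ℂ) :
    r₀ * hs X X ≤ hs X (U * Matrix.of (fun a b => ((r a b : ℝ) : ℂ) * (star U * X * U) a b) * star U) := by
  rw [hs_frameMul_self hU hU', hs_self_eq_frame hU hU' X, Finset.mul_sum]
  refine Finset.sum_le_sum fun a _ => ?_
  rw [Finset.mul_sum]
  refine Finset.sum_le_sum fun b _ => ?_
  nlinarith [hr a b, sq_nonneg ‖(star U * X * U) a b‖]

omit [Nonempty m] [Fintype ι] in
/-- **A frame multiplier with weights of modulus `≤ 1` is an hs-contraction**: `hs(U(w⊙X')U*, U(w⊙X')U*) ≤ hs(X, X)`. [folklore] -/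
theorem hs_frameMul_frameMul_le (hU : star U * U = 1) (hU' : U * star U = 1) {w : m → m → ℂ} (hw : ∀ a b, ‖w a b‖ ≤ 1)
    (X : Matrix m m ℂ) :
    hs (U * Matrix.of (fun a b => w a b * (star U * X * U) a b) * star U)
        (U * Matrix.of (fun a b => w a b * (star U * X * U) a b) * star U) ≤ hs X X := by
  rw [hs_frame hU, hs_self_eq_frame hU hU' X]
  refine Finset.sum_le_sum fun a _ => Finset.sum_le_sum fun b _ => ?_
  rw [Matrix.of_apply, Complex.star_def, Complex.conj_mul', ← Complex.ofReal_pow, Complex.ofReal_re, norm_mul, mul_pow]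
  have h1 : ‖w a b‖ ^ 2 ≤ 1 := by nlinarith [hw a b, norm_nonneg (w a b)]
  nlinarith [sq_nonneg ‖(star U * X * U) a b‖]

omit [Nonempty m] [Fintype ι] in
/-- **`½ad_Z` in the frame of `Z = U diag(−iθ) U*`**: `adh Z X = U·((−iβ_{ab})·X'_{ab})·U*`, `β_{ab} = (θₐ − θ_b)∕2`. [folklore] -/
theorem adh_frame (hU : star U * U = 1) (hU' : U * star U = 1) (θ : m → ℝ) {Z : Matrix m m ℂ}
    (hZU : Z = U * diagonal (fun a => -I * (θ a : ℂ)) * star U) (X : Matrix m m ℂ) :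
    adh Z X = U * Matrix.of (fun a b => (-I * (((θ a - θ b) / 2 : ℝ) : ℂ)) * (star U * X * U) a b) * star U := by
  have hl : ∀ a b, Z * Fu U a b = (-I * (θ a : ℂ)) • Fu U a b := fun a b => by
    rw [hZU]; exact frame_mul_Fu hU _ a b
  have hr : ∀ a b, Fu U a b * Z = (-I * (θ b : ℂ)) • Fu U a b := fun a b => by
    rw [hZU]; exact Fu_mul_frame hU _ a b
  have hadh : ∀ a b, adh Z (Fu U a b) = (-I * (((θ a - θ b) / 2 : ℝ) : ℂ)) • Fu U a b := by
    intro a b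
    rw [adh_apply, hl, hr, ← sub_smul, smul_smul]
    congr 1
    push_cast
    ring
  conv_lhs => rw [(conj_unconj hU' X).symm]
  exact linmap_frame (adh Z) _ hadh _

end FrameMul

end Summit.QuantumFields.YangMills.BalabanUVNodes.N08HaarCompatibilityGuardJacobianContractionFrame

end
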